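import Literature.Dynamics.Hyperbolic.SequenceShadowing

/-!
# Shadowing for a sequence of maps of a Banach space, II: the Green operator (Pilyugin 1999, §1.3.1)

The linear heart of Pilyugin's Theorem 1.3.1 (LNM 1706, proof on pp. 37–38): for a `(λ,N)`-hyperbolic
sequence `(A, P, B)` on a Banach space `E` and a bounded sequence `z : ℤ → E`, the GREEN OPERATOR
`(𝒢 z)_n = P_n z_n + ∑_{m≥1} A_{n-1}⋯A_{n-m} P_{n-m} z_{n-m} - ∑_{m≥0} B_n⋯B_{n+m} Q_{n+m+1} z_{n+m+1}`
(`green`) is well defined (geometrically convergent series), bounded by `N₁ ‖z‖_∞` with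
`N₁ = N(1+λ)/(1-λ)` (`norm_green_le`, Pilyugin's (1.66)), additive (`green_sub`), and solves the linear
inhomogeneous recursion `(𝒢 z)_{n+1} = A_n (𝒢 z)_n + z_{n+1}` (`A_green`, Pilyugin's condition (a2) of
Lemma 1.3.1).  Also the constants `greenBound = N₁` and `shadowConst = L = N₁/(1-κN₁)` of Theorem 1.3.1.
Everything is proved.  Sequel: `SequenceShadowingExistence` (Theorem 1.3.1).

## References

* S. Yu. Pilyugin, *Shadowing in Dynamical Systems*, LNM 1706 (1999), §1.3.1, proof of Theorem 1.3.1. [Pilyugin1999]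
-/

noncomputable section

open Filter Set Function
open scoped Topology NNReal

namespace Literature.Dynamics.Hyperbolic

variable {E : Type*} [NormedAddCommGroup E] [NormedSpace ℝ E]

/-! ## §3 The Green operator of the linear inhomogeneous recursion

For a bounded sequence `z : ℤ → E`, Pilyugin's operator (proof of Theorem 1.3.1, case `k ∈ ℤ`):
`(G z)_n = P_n z_n + ∑_{m ≥ 1} A_{n-1}⋯A_{n-m} P_{n-m} z_{n-m} - ∑_{m ≥ 0} B_n⋯B_{n+m} Q_{n+m+1} z_{n+m+1}`.
It is bounded by `N₁ ‖z‖_∞`, `N₁ = N(1+λ)/(1-λ)`, and solves `(G z)_{n+1} = A_n (G z)_n + z_{n+1}`. -/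

/-- The stable series term `A_{n-1}⋯A_{n-m-1} P_{n-m-1} z_{n-m-1}` (`m ≥ 0`, i.e. chain length `m+1`). [folklore] -/
def stableTerm (A P : ℤ → E →L[ℝ] E) (z : ℤ → E) (n : ℤ) (m : ℕ) : E :=
  stableChain A n (m + 1) (P (n - (m + 1 : ℕ)) (z (n - (m + 1 : ℕ))))

/-- The unstable series term `B_n⋯B_{n+m} Q_{n+m+1} z_{n+m+1}`. [folklore] -/
def unstableTerm (P B : ℤ → E →L[ℝ] E) (z : ℤ → E) (n : ℤ) (m : ℕ) : E :=
  unstableChain B n m (((1 : E →L[ℝ] E) - P (n + m + 1)) (z (n + m + 1)))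

/-- Pilyugin's GREEN OPERATOR `G` (pointwise formula; meaningful for bounded `z`). [cite: Pilyugin1999, Thm 1.3.1 (proof, operator 𝒢)] -/
def green (A P B : ℤ → E →L[ℝ] E) (z : ℤ → E) (n : ℤ) : E :=
  P n (z n) + ∑' m : ℕ, stableTerm A P z n m - ∑' m : ℕ, unstableTerm P B z n m

/-- The Pilyugin constant `N₁ = N (1+λ)/(1-λ)` (norm bound of the Green operator). [cite: Pilyugin1999, Thm 1.3.1] -/
def greenBound (lam N : ℝ) : ℝ := N * (1 + lam) / (1 - lam)

namespace IsHyperbolicSequence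

variable {A P B : ℤ → E →L[ℝ] E} {lam N : ℝ}

/-- Norm bound of the stable term: `‖A_{n-1}⋯ P z‖ ≤ λ^{m+1} N C` when `‖z_k‖ ≤ C`. [folklore] -/
theorem norm_stableTerm_le (h : IsHyperbolicSequence A P B lam N) {z : ℤ → E} {C : ℝ}
    (hz : ∀ k, ‖z k‖ ≤ C) (n : ℤ) (m : ℕ) : ‖stableTerm A P z n m‖ ≤ N * C * lam ^ (m + 1) := by
  unfold stableTerm
  have hmem : P (n - (m + 1 : ℕ)) (z (n - (m + 1 : ℕ))) ∈ stableSpace P (n - (m + 1 : ℕ)) :=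
    apply_mem_stableSpace P _ _
  have h1 := (h.stableChain_apply (m + 1) n _ (by exact_mod_cast hmem)).1
  refine h1.trans ?_
  have h2 : ‖P (n - (m + 1 : ℕ)) (z (n - (m + 1 : ℕ)))‖ ≤ N * C :=
    (h.norm_P_apply_le _ _).trans (mul_le_mul_of_nonneg_left (hz _) h.N_nonneg)
  calc lam ^ (m + 1) * ‖P (n - (m + 1 : ℕ)) (z (n - (m + 1 : ℕ)))‖ ≤ lam ^ (m + 1) * (N * C) :=
        mul_le_mul_of_nonneg_left h2 (pow_nonneg h.lam_nonneg _)
    _ = N * C * lam ^ (m + 1) := by ring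

/-- The stable term lies in `S_n`. [folklore] -/
theorem stableTerm_mem (h : IsHyperbolicSequence A P B lam N) (z : ℤ → E) (n : ℤ) (m : ℕ) :
    stableTerm A P z n m ∈ stableSpace P n :=
  (h.stableChain_apply (m + 1) n _ (by exact_mod_cast apply_mem_stableSpace P _ _)).2

/-- Norm bound of the unstable term: `‖B_n⋯B_{n+m} Q z‖ ≤ λ^{m+1} N C` when `‖z_k‖ ≤ C`. [folklore] -/
theorem norm_unstableTerm_le (h : IsHyperbolicSequence A P B lam N) {z : ℤ → E} {C : ℝ}
    (hz : ∀ k, ‖z k‖ ≤ C) (n : ℤ) (m : ℕ) : ‖unstableTerm P B z n m‖ ≤ N * C * lam ^ (m + 1) := by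
  unfold unstableTerm
  have hmem := apply_mem_unstableSpace P (n + m + 1) (z (n + m + 1))
  have h1 := (h.unstableChain_apply m n _ hmem).1
  refine h1.trans ?_
  have h2 : ‖((1 : E →L[ℝ] E) - P (n + m + 1)) (z (n + m + 1))‖ ≤ N * C :=
    (h.norm_Q_apply_le _ _).trans (mul_le_mul_of_nonneg_left (hz _) h.N_nonneg)
  calc lam ^ (m + 1) * ‖((1 : E →L[ℝ] E) - P (n + m + 1)) (z (n + m + 1))‖ ≤ lam ^ (m + 1) * (N * C) :=
        mul_le_mul_of_nonneg_left h2 (pow_nonneg h.lam_nonneg _)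
    _ = N * C * lam ^ (m + 1) := by ring

/-- The unstable term lies in `U_n`. [folklore] -/
theorem unstableTerm_mem (h : IsHyperbolicSequence A P B lam N) (z : ℤ → E) (n : ℤ) (m : ℕ) :
    unstableTerm P B z n m ∈ unstableSpace P n :=
  (h.unstableChain_apply m n _ (apply_mem_unstableSpace P _ _)).2

/-- The geometric majorant `∑ N C λ^{m+1} = N C λ/(1-λ)`. [folklore] -/
theorem hasSum_majorant (h : IsHyperbolicSequence A P B lam N) (C : ℝ) :
    HasSum (fun m : ℕ => N * C * lam ^ (m + 1)) (N * C * (lam / (1 - lam))) := by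
  have hg := hasSum_geometric_of_lt_one h.lam_nonneg h.lam_lt_one
  have : HasSum (fun m : ℕ => lam ^ (m + 1)) (lam / (1 - lam)) := by
    have h2 := hg.mul_left lam
    simp only [← pow_succ'] at h2
    rwa [div_eq_mul_inv]
  exact this.mul_left (N * C)

/-- **Norm bound of the Green operator**: `‖(G z)_n‖ ≤ N₁ C`, `N₁ = N(1+λ)/(1-λ)`, if `‖z_k‖ ≤ C`
(Pilyugin (1.66)). [cite: Pilyugin1999, Thm 1.3.1 eq. (1.66)] -/
theorem norm_green_le (h : IsHyperbolicSequence A P B lam N) {z : ℤ → E} {C : ℝ}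
    (hz : ∀ k, ‖z k‖ ≤ C) (n : ℤ) : ‖green A P B z n‖ ≤ greenBound lam N * C := by
  have hC : 0 ≤ C := (norm_nonneg _).trans (hz 0)
  have h1 : ‖P n (z n)‖ ≤ N * C := (h.norm_P_apply_le _ _).trans (mul_le_mul_of_nonneg_left (hz _) h.N_nonneg)
  have h2 : ‖∑' m : ℕ, stableTerm A P z n m‖ ≤ N * C * (lam / (1 - lam)) :=
    tsum_of_norm_bounded (h.hasSum_majorant C) (h.norm_stableTerm_le hz n)
  have h3 : ‖∑' m : ℕ, unstableTerm P B z n m‖ ≤ N * C * (lam / (1 - lam)) :=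
    tsum_of_norm_bounded (h.hasSum_majorant C) (h.norm_unstableTerm_le hz n)
  have h1l := h.one_sub_lam_pos
  unfold green greenBound
  calc ‖P n (z n) + ∑' m : ℕ, stableTerm A P z n m - ∑' m : ℕ, unstableTerm P B z n m‖
      ≤ ‖P n (z n)‖ + ‖∑' m : ℕ, stableTerm A P z n m‖ + ‖∑' m : ℕ, unstableTerm P B z n m‖ := by
        have e1 := norm_sub_le (P n (z n) + ∑' m : ℕ, stableTerm A P z n m) (∑' m : ℕ, unstableTerm P B z n m)
        have e2 := norm_add_le (P n (z n)) (∑' m : ℕ, stableTerm A P z n m)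
        linarith
    _ ≤ N * C + N * C * (lam / (1 - lam)) + N * C * (lam / (1 - lam)) := by linarith
    _ = N * (1 + lam) / (1 - lam) * C := by field_simp; ring

variable [CompleteSpace E]

/-- The stable series is summable for bounded `z`. [folklore] -/
theorem summable_stableTerm (h : IsHyperbolicSequence A P B lam N) {z : ℤ → E} {C : ℝ}
    (hz : ∀ k, ‖z k‖ ≤ C) (n : ℤ) : Summable (fun m : ℕ => stableTerm A P z n m) :=
  Summable.of_norm_bounded (h.hasSum_majorant C).summable (h.norm_stableTerm_le hz n)

/-- The unstable series is summable for bounded `z`. [folklore] -/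
theorem summable_unstableTerm (h : IsHyperbolicSequence A P B lam N) {z : ℤ → E} {C : ℝ}
    (hz : ∀ k, ‖z k‖ ≤ C) (n : ℤ) : Summable (fun m : ℕ => unstableTerm P B z n m) :=
  Summable.of_norm_bounded (h.hasSum_majorant C).summable (h.norm_unstableTerm_le hz n)

end IsHyperbolicSequence

/-! ## §4 The Green operator solves the linear inhomogeneous recursion (Pilyugin's (a2) for `𝒢`) -/

namespace IsHyperbolicSequence

variable {A P B : ℤ → E →L[ℝ] E} {lam N : ℝ}

/-- Re-indexing of the stable term one step up: `term_m((G·)_{n+1}) = A_n (A_{n-1}⋯A_{n-m} P_{n-m} z_{n-m})`. [folklore] -/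
theorem stableTerm_succ_eq (A P : ℤ → E →L[ℝ] E) (z : ℤ → E) (n : ℤ) (m : ℕ) :
    stableTerm A P z (n + 1) m = A n (stableChain A n m (P (n - m) (z (n - m)))) := by
  unfold stableTerm
  rw [stableChain_succ_left, ContinuousLinearMap.comp_apply]
  have : n + 1 - ((m + 1 : ℕ) : ℤ) = n - (m : ℤ) := by push_cast; ring
  rw [this]

/-- Re-indexing of the unstable term one step up. [folklore] -/
theorem unstableTerm_succ_eq (h : IsHyperbolicSequence A P B lam N) (z : ℤ → E) (n : ℤ) (m : ℕ) :
    A n (unstableTerm P B z n (m + 1)) = unstableTerm P B z (n + 1) m := by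
  unfold unstableTerm
  rw [unstableChain_succ_left, ContinuousLinearMap.comp_apply]
  have hi : n + ((m + 1 : ℕ) : ℤ) + 1 = n + 1 + (m : ℤ) + 1 := by push_cast; ring
  rw [hi]
  apply h.rightInverse n
  exact (h.unstableChain_apply m (n + 1) _ (apply_mem_unstableSpace P _ _)).2

/-- The head of the unstable series: `A_n B_n Q_{n+1} z_{n+1} = Q_{n+1} z_{n+1}`. [folklore] -/
theorem A_unstableTerm_zero (h : IsHyperbolicSequence A P B lam N) (z : ℤ → E) (n : ℤ) :
    A n (unstableTerm P B z n 0) = ((1 : E →L[ℝ] E) - P (n + 1)) (z (n + 1)) := by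
  unfold unstableTerm
  have hi : n + ((0 : ℕ) : ℤ) + 1 = n + 1 := by push_cast; ring
  rw [unstableChain_zero, hi]
  exact h.rightInverse n _ (apply_mem_unstableSpace P _ _)

/-- The stable term is additive in `z`. [folklore] -/
theorem stableTerm_sub (A P : ℤ → E →L[ℝ] E) (z z' : ℤ → E) (n : ℤ) (m : ℕ) :
    stableTerm A P (fun k => z k - z' k) n m = stableTerm A P z n m - stableTerm A P z' n m := by
  simp only [stableTerm, map_sub]

/-- The unstable term is additive in `z`. [folklore] -/
theorem unstableTerm_sub (P B : ℤ → E →L[ℝ] E) (z z' : ℤ → E) (n : ℤ) (m : ℕ) :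
    unstableTerm P B (fun k => z k - z' k) n m = unstableTerm P B z n m - unstableTerm P B z' n m := by
  simp only [unstableTerm, map_sub]

variable [CompleteSpace E]

/-- STABLE HALF of the recursion: `A_n P_n z_n + A_n ∑_m sTerm(n,m) = ∑_m sTerm(n+1,m)`. [folklore] -/
theorem A_stable_sum (h : IsHyperbolicSequence A P B lam N) {z : ℤ → E} {C : ℝ} (hz : ∀ k, ‖z k‖ ≤ C) (n : ℤ) :
    A n (P n (z n)) + A n (∑' m : ℕ, stableTerm A P z n m) = ∑' m : ℕ, stableTerm A P z (n + 1) m := by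
  set f : ℕ → E := fun m => stableChain A n m (P (n - m) (z (n - m))) with hf
  have hf0 : f 0 = P n (z n) := by simp [hf]
  have hfs : ∀ m, f (m + 1) = stableTerm A P z n m := fun m => rfl
  have hsum1 : Summable (fun m => f (m + 1)) := by
    simp only [hfs]; exact h.summable_stableTerm hz n
  have hsum : Summable f := (summable_nat_add_iff 1).1 hsum1
  have e1 : ∑' m : ℕ, stableTerm A P z (n + 1) m = ∑' m : ℕ, A n (f m) := by
    congr 1; ext m; exact stableTerm_succ_eq A P z n m
  rw [e1, ← ContinuousLinearMap.map_tsum _ hsum, hsum.tsum_eq_zero_add, hf0, map_add]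
  simp only [hfs]

/-- UNSTABLE HALF of the recursion: `A_n ∑_m uTerm(n,m) = Q_{n+1} z_{n+1} + ∑_m uTerm(n+1,m)`. [folklore] -/
theorem A_unstable_sum (h : IsHyperbolicSequence A P B lam N) {z : ℤ → E} {C : ℝ} (hz : ∀ k, ‖z k‖ ≤ C) (n : ℤ) :
    A n (∑' m : ℕ, unstableTerm P B z n m) =
      ((1 : E →L[ℝ] E) - P (n + 1)) (z (n + 1)) + ∑' m : ℕ, unstableTerm P B z (n + 1) m := by
  have hsum : Summable (fun m => unstableTerm P B z n m) := h.summable_unstableTerm hz n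
  rw [ContinuousLinearMap.map_tsum _ hsum, (ContinuousLinearMap.summable _ hsum).tsum_eq_zero_add,
    h.A_unstableTerm_zero z n]
  congr 1
  exact tsum_congr fun m => h.unstableTerm_succ_eq z n m

/-- **The Green operator solves the recursion** (Pilyugin's condition (a2) of Lemma 1.3.1 for `𝒢`):
`A_n (G z)_n = (G z)_{n+1} - z_{n+1}` for bounded `z`. [cite: Pilyugin1999, Thm 1.3.1 (proof)] -/
theorem A_green (h : IsHyperbolicSequence A P B lam N) {z : ℤ → E} {C : ℝ} (hz : ∀ k, ‖z k‖ ≤ C) (n : ℤ) :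
    A n (green A P B z n) = green A P B z (n + 1) - z (n + 1) := by
  unfold green
  rw [map_sub, map_add, h.A_stable_sum hz n, h.A_unstable_sum hz n]
  have e : ((1 : E →L[ℝ] E) - P (n + 1)) (z (n + 1)) = z (n + 1) - P (n + 1) (z (n + 1)) := by
    rw [show ((1 : E →L[ℝ] E) - P (n + 1)) (z (n + 1)) = (1 : E →L[ℝ] E) (z (n + 1)) - P (n + 1) (z (n + 1))
      from rfl, one_apply_eq_self]
  rw [e]
  abel

/-- **The Green operator is additive** on bounded sequences. [folklore] -/
theorem green_sub (h : IsHyperbolicSequence A P B lam N) {z z' : ℤ → E} {C C' : ℝ}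
    (hz : ∀ k, ‖z k‖ ≤ C) (hz' : ∀ k, ‖z' k‖ ≤ C') (n : ℤ) :
    green A P B (fun k => z k - z' k) n = green A P B z n - green A P B z' n := by
  unfold green
  simp only [stableTerm_sub, unstableTerm_sub, map_sub]
  rw [(h.summable_stableTerm hz n).tsum_sub (h.summable_stableTerm hz' n),
    (h.summable_unstableTerm hz n).tsum_sub (h.summable_unstableTerm hz' n)]
  abel

end IsHyperbolicSequence

/-! ## The constants of Theorem 1.3.1 -/

/-- The Pilyugin SHADOWING CONSTANT `L = N₁/(1 - κ N₁)`. [cite: Pilyugin1999, Thm 1.3.1] -/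
def shadowConst (lam N κ : ℝ) : ℝ := greenBound lam N / (1 - κ * greenBound lam N)

namespace IsHyperbolicSequence

variable {A P B : ℤ → E →L[ℝ] E} {lam N : ℝ}

/-- `N₁ ≥ 1`. [folklore] -/
theorem one_le_greenBound (h : IsHyperbolicSequence A P B lam N) : 1 ≤ greenBound lam N := by
  unfold greenBound
  rw [le_div_iff₀ h.one_sub_lam_pos]
  nlinarith [h.one_le_N, h.lam_nonneg]

/-- `N₁ > 0`. [folklore] -/
theorem greenBound_pos (h : IsHyperbolicSequence A P B lam N) : 0 < greenBound lam N :=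
  zero_lt_one.trans_le h.one_le_greenBound

end IsHyperbolicSequence

end Literature.Dynamics.Hyperbolic

end
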